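/-
Copyright (c) 2026 the pub-hodgecm-mathlib formalisation cell (harness21).  R90-TF SLAB, section S10 (Rogawski 1990, §13.8 Prop. 13.8.3 read at `v`),
prover R90-C138-p07 (g0) — (U2) UNCONDITIONAL (DEAL #10 (b) follow-through); h413 = `stmt-HodgeConjecture-24833`, route `HCCMUnconditional`.
-/
import Summits.HodgeConjecture.HodgeConjecture.Theorems.R90S10StSpectralHypAtTransport   -- ★ p863791 (p06): `stSpectralHypAt_of_transport (hG1 : ‹G1›) : LocalTransportStBetaLetter`
import Summits.HodgeConjecture.HodgeConjecture.Theorems.R90S3TransportDelta              -- ★ p863454 (K2E4-p14): `R90.S3.finExplicitDelta_transport` = G1's binders and conclusion VERBATIM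
import HarnessLib

/-!
# R90-TF ∕ S10 — (U2) UNCONDITIONAL: `LocalTransportStBetaLetter` HOLDS (`Theorems/R90S10LocalTransportStBetaHolds.lean`; ns `Summit.HodgeConjecture.HodgeConjecture.R90.S10`)

Print: [Rogawski1990] §13.8 p. 217 l. 9–12 (Props. 13.8.1–13.8.3 are local: «we may choose `E′∕F′` with `E′_{w′} ≅ E_w`»); Lemma 12.7.2 p. 191; §14.2 p. 232; §4.9 p. 55
(the explicit transfer factor `Δ‴_v`).

THE ONE-TERM CERTIFICATE.  ★ p863791 `stSpectralHypAt_of_transport` (p06 (g0)) proves the (U2) socket's statement ★ `LocalTransportStBetaLetter` MODULO ONE named input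
`hG1` = S3's socket G1 `stub_R90_S3_transport_delta` («Rogawski's explicit transfer factor `Δ‴_v` is transported along the ground-field change», ∀-closed over G's
`L H′ v`, bytes VERBATIM).  That socket was PAID 38 minutes earlier by ★ p863454 `R90.S3.finExplicitDelta_transport` (`Theorems/R90S3TransportDelta.lean` :248, K2E4-p14
(g12): «Binders = socket … VERBATIM; conclusion = the socket's BYTES»), so the named input is discharged BY NAME and (U2) holds UNCONDITIONALLY:
`localTransportStBetaLetter_holds : LocalTransportStBetaLetter := stSpectralHypAt_of_transport finExplicitDelta_transport` — the kernel certifies that G1's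
∀-closed socket bytes and the ★ payer's statement coincide.  FILE U's pay line is then `sock_S10_localTransportStBeta := localTransportStBetaLetter_holds` with ★
imports only (LAW L9: no `Cruxes/…/Lines` import needed for the S3 socket).
HONEST LABEL: ★ helper; (U2) PAID IN FULL once FILE U's edition names it and builds; (U1) `E1St1383LetterUnr` (S10's head, modulo A's sockets) and (U3) are unchanged;
HC_CM is proved only modulo the 7 printed citations (2 remaining named inputs: hLiu418 = `stmt-HodgeConjecture-24832`, h413 = `stmt-HodgeConjecture-24833`) until rung 0
closes; REL ≠ ★ ≠ BUILT.
-/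

set_option autoImplicit false
set_option linter.dupNamespace false

noncomputable section

namespace Summit.HodgeConjecture.HodgeConjecture.R90.S10

/-- **(U2) UNCONDITIONAL — `LocalTransportStBetaLetter` HOLDS**: the local transport of the organ (S-β) along S3's datum `(Φ, hc, hc′, hΦσ, hΦμ, hΦη, hΦψ)`,
★ p863791 `stSpectralHypAt_of_transport` with its one named input `hG1` (S3's G1, the transport of the explicit factor `Δ‴_v`) discharged by the ★ payer
`R90.S3.finExplicitDelta_transport` (p863454).  [cite: Rogawski1990, §13.8 p. 217 l. 9–12; Lemma 12.7.2 p. 191; §14.2 p. 232; §4.9 p. 55]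
[cite: PlatonovRapinchuk1994, §5.1] -/
theorem localTransportStBetaLetter_holds : LocalTransportStBetaLetter :=
  stSpectralHypAt_of_transport Summit.HodgeConjecture.HodgeConjecture.R90.S3.finExplicitDelta_transport

end Summit.HodgeConjecture.HodgeConjecture.R90.S10

end
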